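import Mathlib
import Summits.Ventures.PercRepro2.V2SP
import Summits.Ventures.PercRepro2.Tail2DTailAvg
import Summits.Ventures.PercRepro2.Tail2DStochDom

/-!
# The reduction of the whole pin-free off-axis family to (SD)
(seat mine-b, cell pub-perc-repro2; conjectures/MINE-B.md §41)

`Tail2DTailAvg.lean` reduces the whole anti-diagonal unimodality of the tails on pin-free patterns to the
tail-average monotonicity (T-AVG) at every tail point (`offaxis_of_tailAvg`), and `Tail2DStochDom.lean` derives
(T-AVG) from the stochastic domination (SD) of the conditioned tails (`tailAvg_of_sdomZ`).  Composing: **if (SD)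
holds at every clipped position on every pin-free pattern, then `T(a,j) ≤ T(a−1,j+1)` for every `j + 2 ≤ a` on every
pin-free pattern** — every member of the family of record, the wall `(7,5)` included (`offaxis_all_of_sdomZ`).
Since (SD) is closed under series composition (`sdomZ_ser`) and holds on the atoms, the hypothesis is equivalent to
its PARALLEL STEP alone: (SD) on two pin-free patterns at every position implies (SD) on their parallel composition
(`offaxis_all_of_sdomZ_par`).  Census of (SD): 0 violations at every position on all 6,965 pin-free SP networks
with ≤ 10 edges (exact max-flow over all increasing events, §41.6).
-/

namespace Summit.Ventures.PercRepro2.Tail2D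

open V2Closure

/-- **(SD) everywhere ⟹ the whole pin-free off-axis family**: `T(a,j) ≤ T(a−1,j+1)` for `j + 2 ≤ a` -/
theorem offaxis_all_of_sdomZ (hSD : ∀ s : V2Closure.SP, PinFree s → ∀ u v : ℤ, SDomZ s u v)
    {s : V2Closure.SP} (hs : PinFree s) (a j : ℕ) (hja : j + 2 ≤ a) :
    tailCount s a j ≤ tailCount s (a - 1) (j + 1) := by
  have h := offaxis_of_tailAvg hs (fun a' c' _ => tailAvg_of_sdomZ s a' c' (hSD s hs a' c')) j a (by omega)
  rw [tailCount_symm s a j, tailCount_symm s (a - 1) (j + 1)]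
  exact h

/-- **(SD) at every position on every pin-free pattern follows from its parallel step** (the series step is
`sdomZ_ser`, the atoms `sdomZ_free` / `sdomZ_absent`) -/
theorem sdomZ_all_of_par
    (hpar : ∀ s t : V2Closure.SP, PinFree s → PinFree t → (∀ u v : ℤ, SDomZ s u v) → (∀ u v : ℤ, SDomZ t u v) →
      ∀ u v : ℤ, SDomZ (V2Closure.SP.par s t) u v) :
    ∀ {s : V2Closure.SP}, PinFree s → ∀ u v : ℤ, SDomZ s u v
  | _, .free, u, v => sdomZ_free u v
  | _, .absent, u, v => sdomZ_absent u v
  | _, .ser hs ht, u, v => sdomZ_ser _ _ u v (sdomZ_all_of_par hpar hs u v) (sdomZ_all_of_par hpar ht u v)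
  | _, .par hs ht, u, v =>
      hpar _ _ hs ht (fun u' v' => sdomZ_all_of_par hpar hs u' v') (fun u' v' => sdomZ_all_of_par hpar ht u' v') u v

/-- **under the parallel step of (SD): the whole anti-diagonal unimodality of the tails on every pin-free
pattern** — `T(a,j) ≤ T(a−1,j+1)` for every `j + 2 ≤ a` (every member, including the open column `j = 5`) -/
theorem offaxis_all_of_sdomZ_par
    (hpar : ∀ s t : V2Closure.SP, PinFree s → PinFree t → (∀ u v : ℤ, SDomZ s u v) → (∀ u v : ℤ, SDomZ t u v) →
      ∀ u v : ℤ, SDomZ (V2Closure.SP.par s t) u v)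
    {s : V2Closure.SP} (hs : PinFree s) (a j : ℕ) (hja : j + 2 ≤ a) :
    tailCount s a j ≤ tailCount s (a - 1) (j + 1) :=
  offaxis_all_of_sdomZ (fun _ ht u v => sdomZ_all_of_par hpar ht u v) hs a j hja

end Summit.Ventures.PercRepro2.Tail2D
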